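import Mathlib
import Summits.Ventures.HodgeRepro2.T5AdicCompletionIntegral
import Summits.Ventures.HodgeRepro2.T5AdicCompletionLocalField
import Summits.Ventures.HodgeRepro2.T5UnramifiedCharacter
import Summits.Ventures.HodgeRepro2.T5ValuedBallBasis
import Summits.Ventures.HodgeRepro2.T5OpenCompactCharacterExtension
import Summits.Ventures.HodgeRepro2.T5AdicCompletionHenselian

/-!
# The completion map `Kv → Lw` is a topological embedding; characters of `F_v^×` extend to `E_v^×`

On Mathlib's completions `Kv := v.adicCompletion K ⊆ Lw := w.adicCompletion L` of number fields
(`[Algebra Kv Lw] [ContinuousSMul Kv Lw]`, the setting of `T5AdicCompletionIntegral`, row 75;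
`T5AdicCompletionMap`, row 79, supplies these instances from `[w.asIdeal.LiesOver v.asIdeal]`):

* `isInducing_algebraMap` / `isEmbedding_algebraMap`: the continuous inclusion `Kv → Lw` is a
  topological embedding — from row 75's `w(alg x) = (v x)^e` (`e ≥ 1`) and the ball bases of both
  valuation topologies (row 73);
* `isInducing_unitsMap` (general): `Units.map` of an inducing monoid hom is inducing (through
  `Units.embedProduct`), hence `isEmbedding_baseUnits`: `F_v^× = Kvˣ ↪ E_v^× = Lwˣ` is a
  topological embedding;
* THE DATUM FORM of «μ|_{F_v^×} = η_v exists» (route/T5-route-2.md, Lemma N5.L4(ii) / §N5.12; the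
  last item of CHECK-N5 §17's still-prose list with an elementary core):
  `exists_continuous_comp_baseUnits_eq` — every continuous character `η` of `Kvˣ` is `μ ∘ baseUnits`
  for a continuous character `μ` of `Lwˣ` (Circle-valued; unitary `ℂˣ` form
  `exists_continuous_comp_baseUnits_eq_units`).  Instantiates `T5OpenCompactCharacterExtension` on
  `Lwˣ` with the open compact totally disconnected subgroup `adicIntegerUnits = O_Lwˣ` built here from
  the compact `O_Lw` of `T5AdicCompletionHenselian` (no normed-field instance needed).

Declaration per README §8(d): «uses an L-value-free non-vanishing device: NO».
-/

namespace Summit.Ventures.HodgeRepro2.T5AdicCompletionEmbedding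

open Topology IsDedekindDomain HeightOneSpectrum WithZero

section Units

variable {M N : Type*} [Monoid M] [Monoid N] [TopologicalSpace M] [TopologicalSpace N]

omit [TopologicalSpace M] [TopologicalSpace N] in
/-- `Units.embedProduct` intertwines `Units.map f` with `Prod.map f (op ∘ f ∘ unop)`. -/
theorem embedProduct_comp_map (f : M →* N) :
    (Units.embedProduct N) ∘ (Units.map f) =
      (Prod.map f (MulOpposite.op ∘ f ∘ MulOpposite.unop)) ∘ Units.embedProduct M := by
  funext u
  simp [Units.embedProduct]

/-- `Units.map` of an inducing monoid hom is inducing. -/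
theorem isInducing_unitsMap (f : M →* N) (hf : IsInducing f) : IsInducing (Units.map f) := by
  rw [← (Units.isEmbedding_embedProduct (M := N)).isInducing.of_comp_iff, embedProduct_comp_map]
  refine IsInducing.comp (IsInducing.prodMap hf ?_) Units.isEmbedding_embedProduct.isInducing
  have : (MulOpposite.op ∘ f ∘ MulOpposite.unop : Mᵐᵒᵖ → Nᵐᵒᵖ) =
      (MulOpposite.opHomeomorph : N ≃ₜ Nᵐᵒᵖ) ∘ (f ∘ (MulOpposite.opHomeomorph : M ≃ₜ Mᵐᵒᵖ).symm) := rfl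
  rw [this]
  exact MulOpposite.opHomeomorph.isInducing.comp
    (hf.comp MulOpposite.opHomeomorph.symm.isInducing)

/-- `Units.map` of a monoid hom that is a topological embedding is a topological embedding. -/
theorem isEmbedding_unitsMap (f : M →* N) (hf : IsEmbedding f) : IsEmbedding (Units.map f) :=
  ⟨isInducing_unitsMap f hf.isInducing, Units.map_injective hf.injective⟩

end Units

variable {K : Type*} [Field K] [NumberField K] (v : HeightOneSpectrum (NumberField.RingOfIntegers K))
  {L : Type*} [Field L] [NumberField L] (w : HeightOneSpectrum (NumberField.RingOfIntegers L))
  [Algebra (v.adicCompletion K) (w.adicCompletion L)]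
  [ContinuousSMul (v.adicCompletion K) (w.adicCompletion L)]

/-- The inclusion `Kv → Lw` is inducing: `w(alg x) = (v x)^e` with `e ≥ 1` (row 75) makes the
`w`-ball of radius `exp (e k)` pull back into the `v`-ball of radius `exp k`. -/
theorem isInducing_algebraMap : IsInducing (algebraMap (v.adicCompletion K) (w.adicCompletion L)) := by
  obtain ⟨e, he, hval⟩ := T5AdicCompletionIntegral.exists_val_algebraMap_eq_pow v w
  rw [IsTopologicalAddGroup.isInducing_iff_nhds_zero]
  apply le_antisymm
  · rw [← Filter.map_le_iff_le_comap]
    have hc := (continuous_algebraMap (v.adicCompletion K) (w.adicCompletion L)).tendsto 0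
    rwa [map_zero] at hc
  · intro s hs
    obtain ⟨k, hk⟩ := T5ValuedBallBasis.exists_forall_le_exp_mem_of_mem_nhds_zero hs
    refine Filter.mem_comap.mpr ⟨{y : w.adicCompletion L | Valued.v y ≤ exp (e • k)},
      T5ValuedBallBasis.ball_mem_nhds_zero _, fun x hx => hk x ?_⟩
    simp only [Set.mem_preimage, Set.mem_setOf_eq, hval, exp_nsmul] at hx
    exact (pow_le_pow_iff_left₀ zero_le zero_le he.ne').mp hx

/-- The inclusion `Kv → Lw` is a topological embedding. -/
theorem isEmbedding_algebraMap :
    IsEmbedding (algebraMap (v.adicCompletion K) (w.adicCompletion L)) :=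
  ⟨isInducing_algebraMap v w, (algebraMap (v.adicCompletion K) (w.adicCompletion L)).injective⟩

/-- The inclusion `Kv → Lw` is a closed embedding (`Kv` is complete): `F_v` is a closed subfield of
`E_v`. -/
theorem isClosedEmbedding_algebraMap :
    IsClosedEmbedding (algebraMap (v.adicCompletion K) (w.adicCompletion L)) :=
  (AddMonoidHom.isUniformEmbedding_of_isEmbedding (isEmbedding_algebraMap v w)).isClosedEmbedding

/-- The image of `Kv` in `Lw` is closed. -/
theorem isClosed_range_algebraMap :
    IsClosed (Set.range (algebraMap (v.adicCompletion K) (w.adicCompletion L))) :=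
  (isClosedEmbedding_algebraMap v w).isClosed_range

/-- `F_v^× ↪ E_v^×` (`T5UnramifiedCharacter.baseUnits`) is a topological embedding. -/
theorem isEmbedding_baseUnits : IsEmbedding (T5UnramifiedCharacter.baseUnits v w) :=
  isEmbedding_unitsMap _ (isEmbedding_algebraMap v w)

section IntegerUnits

variable {M : Type*} [Field M] [NumberField M] (u : HeightOneSpectrum (NumberField.RingOfIntegers M))

/-- `O_Kvᵐᵒᵖ` is totally disconnected. -/
theorem totallyDisconnectedSpace_mulOpposite :
    TotallyDisconnectedSpace (adicCompletionIntegers M u)ᵐᵒᵖ := by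
  have h := (MulOpposite.opHomeomorph (M := adicCompletionIntegers M u)).symm.isEmbedding.isTotallyDisconnected_range
  rw [(MulOpposite.opHomeomorph (M := adicCompletionIntegers M u)).symm.surjective.range_eq] at h
  exact h.mp (isTotallyDisconnected_of_totallyDisconnectedSpace _)

/-- `O_Kvˣ` is totally disconnected (through `Units.embedProduct`). -/
theorem totallyDisconnectedSpace_adicCompletionIntegers_units : TotallyDisconnectedSpace (adicCompletionIntegers M u)ˣ := by
  haveI := totallyDisconnectedSpace_mulOpposite u
  exact Units.isEmbedding_embedProduct.isTotallyDisconnected_range.mp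
    (isTotallyDisconnected_of_totallyDisconnectedSpace _)

/-- The range of `Units.embedProduct` is closed: `{(a, op b) | a b = 1 ∧ b a = 1}`. -/
theorem isClosed_range_embedProduct :
    IsClosed (Set.range (Units.embedProduct (adicCompletionIntegers M u))) := by
  have : Set.range (Units.embedProduct (adicCompletionIntegers M u)) =
      {p : adicCompletionIntegers M u × (adicCompletionIntegers M u)ᵐᵒᵖ | p.1 * p.2.unop = 1} ∩
        {p | p.2.unop * p.1 = 1} := by
    ext ⟨a, b⟩
    simp only [Set.mem_range, Set.mem_inter_iff, Set.mem_setOf_eq, Units.embedProduct_apply, Prod.mk.injEq]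
    constructor
    · rintro ⟨x, rfl, rfl⟩
      simp
    · rintro ⟨h1, h2⟩
      exact ⟨⟨a, b.unop, h1, h2⟩, rfl, by simp⟩
  rw [this]
  exact (isClosed_eq (continuous_fst.mul (MulOpposite.continuous_unop.comp continuous_snd)) continuous_const).inter
    (isClosed_eq ((MulOpposite.continuous_unop.comp continuous_snd).mul continuous_fst) continuous_const)

/-- `O_Kvˣ` is compact (a closed subset of the compact `O_Kv × O_Kvᵐᵒᵖ`). -/
theorem compactSpace_adicCompletionIntegers_units : CompactSpace (adicCompletionIntegers M u)ˣ := by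
  rw [← isCompact_univ_iff, Units.isEmbedding_embedProduct.isCompact_iff, Set.image_univ]
  exact (isClosed_range_embedProduct u).isCompact

/-- The image of `O_Kvˣ` in `Kvˣ`. -/
noncomputable def adicIntegerUnits : Subgroup (adicCompletion M u)ˣ :=
  (Units.map ((adicCompletionIntegers M u).subtype : adicCompletionIntegers M u →* adicCompletion M u)).range

/-- Membership in `adicIntegerUnits`: `x` and `x⁻¹` integral. -/
theorem mem_adicIntegerUnits_iff (x : (adicCompletion M u)ˣ) :
    x ∈ adicIntegerUnits u ↔ (x : adicCompletion M u) ∈ adicCompletionIntegers M u ∧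
      ((x⁻¹ : (adicCompletion M u)ˣ) : adicCompletion M u) ∈ adicCompletionIntegers M u := by
  constructor
  · rintro ⟨y, rfl⟩
    refine ⟨?_, ?_⟩
    · rw [Units.coe_map]; exact (y : adicCompletionIntegers M u).2
    · rw [← map_inv, Units.coe_map]
      exact ((y⁻¹ : (adicCompletionIntegers M u)ˣ) : adicCompletionIntegers M u).2
  · rintro ⟨h1, h2⟩
    refine ⟨⟨⟨_, h1⟩, ⟨_, h2⟩, Subtype.ext (by simp), Subtype.ext (by simp)⟩, Units.ext rfl⟩

/-- `adicIntegerUnits` is open in `Kvˣ`. -/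
theorem isOpen_adicIntegerUnits : IsOpen ((adicIntegerUnits u : Subgroup (adicCompletion M u)ˣ) : Set (adicCompletion M u)ˣ) := by
  have : ((adicIntegerUnits u : Subgroup (adicCompletion M u)ˣ) : Set (adicCompletion M u)ˣ) =
      (Units.val ⁻¹' (adicCompletionIntegers M u : Set (adicCompletion M u))) ∩
        ((fun x : (adicCompletion M u)ˣ => ((x⁻¹ : (adicCompletion M u)ˣ) : adicCompletion M u)) ⁻¹'
          (adicCompletionIntegers M u : Set (adicCompletion M u))) := by
    ext x
    simp only [SetLike.mem_coe, Set.mem_inter_iff, Set.mem_preimage]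
    exact mem_adicIntegerUnits_iff u x
  rw [this]
  exact ((Valued.isOpen_valuationSubring _).preimage Units.continuous_val).inter
    ((Valued.isOpen_valuationSubring _).preimage Units.continuous_coe_inv)

/-- The inclusion `O_Kvˣ →* Kvˣ` is a closed embedding. -/
theorem isClosedEmbedding_adicUnitsMap :
    IsClosedEmbedding (Units.map ((adicCompletionIntegers M u).subtype : adicCompletionIntegers M u →* adicCompletion M u)) := by
  haveI := compactSpace_adicCompletionIntegers_units u
  exact (Units.continuous_map continuous_subtype_val).isClosedEmbedding (Units.map_injective Subtype.val_injective)

/-- `adicIntegerUnits` is compact. -/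
instance compactSpace_adicIntegerUnits : CompactSpace (adicIntegerUnits u) := by
  haveI := compactSpace_adicCompletionIntegers_units u
  have hc : IsCompact (Set.range (Units.map ((adicCompletionIntegers M u).subtype :
      adicCompletionIntegers M u →* adicCompletion M u))) :=
    isCompact_range (Units.continuous_map continuous_subtype_val)
  rw [← MonoidHom.coe_range] at hc
  exact isCompact_iff_compactSpace.mp hc

/-- `adicIntegerUnits` is totally disconnected. -/
instance totallyDisconnectedSpace_adicIntegerUnits : TotallyDisconnectedSpace (adicIntegerUnits u) := by
  haveI := totallyDisconnectedSpace_adicCompletionIntegers_units u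
  have h1 : IsTotallyDisconnected (Set.range (Units.map ((adicCompletionIntegers M u).subtype :
      adicCompletionIntegers M u →* adicCompletion M u))) :=
    (isClosedEmbedding_adicUnitsMap u).isEmbedding.isTotallyDisconnected_range.mpr inferInstance
  rw [← MonoidHom.coe_range] at h1
  exact (IsEmbedding.subtypeVal.isTotallyDisconnected_range).mp (by rwa [Subtype.range_coe])

/-- Every continuous character of ANY subgroup of `Kvˣ` extends continuously. -/
theorem exists_continuous_extension_circle' (H : Subgroup (adicCompletion M u)ˣ) (χ : H →* Circle)
    (hχ : Continuous χ) : ∃ χ' : (adicCompletion M u)ˣ →* Circle, Continuous χ' ∧ ∀ h : H, χ' h = χ h :=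
  T5OpenCompactCharacterExtension.exists_continuous_extension_circle (adicIntegerUnits u) (isOpen_adicIntegerUnits u) H χ hχ

end IntegerUnits

/-- THE DATUM FORM: every continuous character `η : Kvˣ →* Circle` (e.g. the quadratic character
`η_v` of `E_v/F_v`) is the restriction `μ ∘ baseUnits` of a continuous character `μ` of `Lwˣ`. -/
theorem exists_continuous_comp_baseUnits_eq (η : (v.adicCompletion K)ˣ →* Circle)
    (hη : Continuous η) :
    ∃ μ : (w.adicCompletion L)ˣ →* Circle, Continuous μ ∧
      ∀ x : (v.adicCompletion K)ˣ, μ (T5UnramifiedCharacter.baseUnits v w x) = η x :=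
  T5OpenCompactCharacterExtension.exists_continuous_comp_eq_of_isEmbedding (adicIntegerUnits w)
    (isOpen_adicIntegerUnits w) (T5UnramifiedCharacter.baseUnits v w) (isEmbedding_baseUnits v w) η hη

/-- The unitary `ℂˣ`-valued form of `exists_continuous_comp_baseUnits_eq`. -/
theorem exists_continuous_comp_baseUnits_eq_units (η : (v.adicCompletion K)ˣ →* ℂˣ)
    (hη : Continuous η) (hunit : ∀ x, ‖(η x : ℂ)‖ = 1) :
    ∃ μ : (w.adicCompletion L)ˣ →* ℂˣ, Continuous μ ∧
      (∀ x : (v.adicCompletion K)ˣ, μ (T5UnramifiedCharacter.baseUnits v w x) = η x) ∧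
        ∀ y : (w.adicCompletion L)ˣ, ‖(μ y : ℂ)‖ = 1 :=
  T5OpenCompactCharacterExtension.exists_continuous_comp_eq_units_of_isEmbedding (adicIntegerUnits w)
    (isOpen_adicIntegerUnits w) (T5UnramifiedCharacter.baseUnits v w) (isEmbedding_baseUnits v w) η hη hunit

/-- THE USE (Lemma N5.L4(ii)'s twist): if `ξ` is a continuous character of `Lwˣ` trivial on
`F_v^× = baseUnits` (conjugate-orthogonal) and `η` any continuous character of `Kvˣ`, then `ξ · μ`
restricts to `η` for the `μ` of `exists_continuous_comp_baseUnits_eq` (conjugate-symplectic when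
`η = η_v`). -/
theorem exists_mul_comp_baseUnits_eq (ξ : (w.adicCompletion L)ˣ →* Circle) (hξ : Continuous ξ)
    (hξ1 : ∀ x : (v.adicCompletion K)ˣ, ξ (T5UnramifiedCharacter.baseUnits v w x) = 1)
    (η : (v.adicCompletion K)ˣ →* Circle) (hη : Continuous η) :
    ∃ μ : (w.adicCompletion L)ˣ →* Circle, Continuous (ξ * μ) ∧
      ∀ x : (v.adicCompletion K)ˣ, (ξ * μ) (T5UnramifiedCharacter.baseUnits v w x) = η x := by
  obtain ⟨μ, hμ, hμη⟩ := exists_continuous_comp_baseUnits_eq v w η hη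
  refine ⟨μ, ?_, fun x => ?_⟩
  · exact hξ.mul hμ
  · rw [MonoidHom.mul_apply, hξ1 x, hμη x, one_mul]

/-- Every continuous character of ANY subgroup of `E_v^× = Lwˣ` extends continuously. -/
theorem exists_continuous_extension_circle (H : Subgroup (adicCompletion L w)ˣ)
    (χ : H →* Circle) (hχ : Continuous χ) :
    ∃ χ' : (adicCompletion L w)ˣ →* Circle, Continuous χ' ∧ ∀ h : H, χ' h = χ h :=
  exists_continuous_extension_circle' w H χ hχ

end Summit.Ventures.HodgeRepro2.T5AdicCompletionEmbedding
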